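/-
Origin: expansion seat `planner-pub-hodgecm-qw8-g11-0`, handover #21 SPLIT PART 2/4 of tree `HodgeCM/Model/Toy/LefQuartic.lean` 7081025a (1140 l. > 400-line cap) = NEW module `HodgeCM.Model.Toy.LefQuarticTwist` md5 36c99ceea101faa5de47e7ea845ac0aa (328 l.): verbatim section-boundary slice + docstrings; imports: `import Qw8g11.LefQuarticSign` -> `import HodgeCM.Model.Toy.LefQuarticSign` (row #20); check-wip LANDABLE rc 0 / 0 warnings / 0 proof-hole; lean -DautoImplic (`HOME/pub-hodgecm-qw8-g11/lean/Qw8g11/LefQuarticTwist.lean`, md5 36c99cee, 328 lines);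
landed by the packager successor (mc-unitary-1-g3, gen-8 kit) in gate run 32 as `HodgeCM/Model/Toy/LefQuarticTwist.lean` (import ^import Qw8g11\.LefQuarticSign[ \t]*$→import HodgeCM.Model.Toy.LefQuarticSign ×1).
-/
-- HANDOVER (planner-pub-hodgecm-qw8-g11-0, unit pub-hodgecm-qw8-g11): SPLIT PART 2/4 of the installed
-- `HodgeCM.Model.Toy.LefQuartic` (md5 7081025a, 1140 l.) = its §§5–7a (ll. 377–642: homogeneity, `Ω_K` = `twistSet`, pair orbits,
-- `Trichot`/`TriInner`, same place, degree 2) verbatim + docstrings; WIP module `Qw8g11.LefQuarticTwist`, intended final module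
-- `HodgeCM.Model.Toy.LefQuarticTwist` (NEW file); at landing rewrite `import Qw8g11.LefQuarticSign` ↦ `import HodgeCM.Model.Toy.LefQuarticSign`.
/-
Copyright: pub-hodgecm cell (HodgeCMPerL). Separating-model layer (gen 8 of the [QW8] §2.5 lineage). New file.
-/
import Summits.HodgeConjecture.HodgeCM.Model.Toy.LefQuarticSign

/-!
# The Lefschetz model in CM degree at most four, II: `Ω_K`, pair orbits and the trichotomy `TriInner`

Split part 2/4 of `HodgeCM.Model.Toy.LefQuartic` (its §§5–7a, unchanged).

* §5 homogeneity: equal fibres under a transitive family of injections (orbit–stabiliser, group-free: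
  `card_fibre_eq_of_homogeneous`, `sum_eq_card_fibre_mul_sum`).
* §6 the finite set `Ω_K = twistSet K ⊆ Sym(Hom(K,ℂ))` of permutations `σ ↦ γ • σ` induced by `Aut_ℚ(ℚ̄)` (no quotient of the
  Galois group is formed) and its pair orbits `pairSet x y`; both are HOMOGENEOUS, so sums over `Ω_K` push forward to one- and
  two-slot images (`sum_twistSet_eval`, `sum_twistSet_eval₂`).
* §7a `Trichot n v` (`v ∈ {0, ±n}`) and THE TRICHOTOMY `TriInner K`: for all CM types `Ψ, Ψ'` and embeddings `x, y` the inner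
  product over `Ω_K` of the slot sign vectors is `0` or `±#Ω_K`; proved here for slots over the same place
  (`tri_inner_of_same_place`) and in CM degree `2` (`triInner_of_finrank_eq_two`); degree `4` and the balance argument are in
  `HodgeCM.Model.Toy.LefQuarticInner`.

Nothing here is cited: kernel facts about an explicit model.
-/

noncomputable section

set_option backward.isDefEq.respectTransparency false

namespace HodgeCM.Toy

open scoped TensorProduct
open exteriorPower Module CMPresentation CMTypeOps
open NumberField.ComplexEmbedding (conjugate)
open Literature.AlgebraicGeometry.Motives
open Literature.AlgebraicGeometry.Motives.HodgeStructure (ofRat ofRat_apply mem_hodgeClasses_iff)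
open Literature.AlgebraicGeometry.ShimuraVarieties (conjRingHomK embedding_conjRingHomK)

/-! ### 5. Homogeneity: equal fibres under a transitive family of injections (orbit–stabiliser, group-free) -/

section Homogeneous

variable {ι α β : Type*} [DecidableEq β] {S : Finset α} {a : ι → α → α}
  (hS : ∀ i, ∀ s ∈ S, a i s ∈ S) (hinj : ∀ i, Function.Injective (a i))
  (htr : ∀ s ∈ S, ∀ t ∈ S, ∃ i, a i s = t) {F : α → β} {act : ι → β → β}
  (hF : ∀ i s, F (a i s) = act i (F s))
include hS hinj htr hF

/-- If a family of injections `a i : α → α` preserves a finite set `S` and is transitive on it, and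
`F : α → β` intertwines it with self-maps `act i` of `β`, then all non-empty fibres of `F` on `S` have the
same size. -/
theorem card_fibre_eq_of_homogeneous {s t : α} (hs : s ∈ S) (ht : t ∈ S) :
    (S.filter fun u => F u = F s).card = (S.filter fun u => F u = F t).card := by
  have key : ∀ {s t : α}, s ∈ S → t ∈ S →
      (S.filter fun u => F u = F s).card ≤ (S.filter fun u => F u = F t).card := by
    intro s t hs ht
    obtain ⟨i, hi⟩ := htr s hs t ht
    refine Finset.card_le_card_of_injOn (a i) (fun u hu => ?_) (hinj i).injOn
    rw [Finset.mem_coe, Finset.mem_filter] at hu ⊢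
    exact ⟨hS i u hu.1, by rw [hF, hu.2, ← hF, hi]⟩
  exact le_antisymm (key hs ht) (key ht hs)

/-- … so a sum of `h ∘ F` over `S` is (common fibre size) × (the sum of `h` over the image) … -/
theorem sum_eq_card_fibre_mul_sum (h : β → ℤ) {s₀ : α} (hs₀ : s₀ ∈ S) :
    ∑ u ∈ S, h (F u) = ((S.filter fun u => F u = F s₀).card : ℤ) * ∑ b ∈ S.image F, h b := by
  rw [Finset.sum_comp, Finset.mul_sum]
  refine Finset.sum_congr rfl fun b hb => ?_
  obtain ⟨t, ht, rfl⟩ := Finset.mem_image.mp hb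
  rw [nsmul_eq_mul, card_fibre_eq_of_homogeneous hS hinj htr hF ht hs₀]

/-- … and `#S` is (common fibre size) × (size of the image). -/
theorem card_eq_card_fibre_mul {s₀ : α} (hs₀ : s₀ ∈ S) :
    S.card = (S.filter fun u => F u = F s₀).card * (S.image F).card := by
  rw [Finset.card_eq_sum_card_image F S, mul_comm, ← smul_eq_mul, ← Finset.sum_const]
  refine Finset.sum_congr rfl fun b hb => ?_
  obtain ⟨t, ht, rfl⟩ := Finset.mem_image.mp hb
  rw [card_fibre_eq_of_homogeneous hS hinj htr hF ht hs₀]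

end Homogeneous

/-! ### 6. The finite set `Ω_K` of Galois permutations of the embeddings, and its pair orbits -/

section TwistSet

open scoped Classical

variable (K : Type) [Field K] [NumberField K]

/-- `Ω_K`: the permutations `σ ↦ γ • σ` of `Hom(K, ℂ)` induced by the elements `γ ∈ Aut_ℚ(ℚ̄)` — the image of
the absolute Galois group in `Sym(Hom(K,ℂ))`, as a finite set of functions (no quotient, no `Fintype Gam`) -/
def twistSet : Finset ((K →+* ℂ) → (K →+* ℂ)) :=
  Finset.univ.filter fun f => ∃ γ : Gam, (twist γ : (K →+* ℂ) → (K →+* ℂ)) = f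

variable {K}

/-- membership in `Ω_K`: `f ∈ Ω_K` iff `f` is the twist by some `γ ∈ Aut_ℚ(ℚ̄)` -/
theorem mem_twistSet {f : (K →+* ℂ) → (K →+* ℂ)} :
    f ∈ twistSet K ↔ ∃ γ : Gam, (twist γ : (K →+* ℂ) → (K →+* ℂ)) = f := by
  unfold twistSet
  rw [Finset.mem_filter]
  exact ⟨fun h => h.2, fun h => ⟨Finset.mem_univ _, h⟩⟩

/-- every twist `γ • _` lies in `Ω_K` -/
theorem twist_mem_twistSet (γ : Gam) : (twist γ : (K →+* ℂ) → (K →+* ℂ)) ∈ twistSet K :=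
  mem_twistSet.mpr ⟨γ, rfl⟩

/-- the identity lies in `Ω_K` -/
theorem id_mem_twistSet : (id : (K →+* ℂ) → (K →+* ℂ)) ∈ twistSet K :=
  mem_twistSet.mpr ⟨1, funext twist_one⟩

/-- `Ω_K` is nonempty -/
theorem twistSet_card_pos : 0 < (twistSet K).card := Finset.card_pos.mpr ⟨_, id_mem_twistSet⟩

/-- `Ω_K` is stable under post-composition with a twist -/
theorem comp_mem_twistSet (γ : Gam) :
    ∀ f ∈ twistSet K, (twist γ ∘ f : (K →+* ℂ) → (K →+* ℂ)) ∈ twistSet K := fun f hf => by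
  obtain ⟨δ, rfl⟩ := mem_twistSet.mp hf
  exact mem_twistSet.mpr ⟨γ * δ, funext fun σ => twist_mul γ δ σ⟩

/-- post-composition with a twist is injective on self-maps of `Hom(K, ℂ)` -/
theorem comp_twist_injective (γ : Gam) :
    Function.Injective fun f : (K →+* ℂ) → (K →+* ℂ) => (twist γ ∘ f : (K →+* ℂ) → (K →+* ℂ)) :=
  fun _ _ h => funext fun σ => twist_injective γ (congrFun h σ)

/-- `Ω_K` is homogeneous under post-composition with twists -/
theorem twistSet_transitive :
    ∀ f ∈ twistSet K, ∀ f' ∈ twistSet K, ∃ γ : Gam, (twist γ ∘ f : (K →+* ℂ) → (K →+* ℂ)) = f' := by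
  intro f hf f' hf'
  obtain ⟨δ, rfl⟩ := mem_twistSet.mp hf
  obtain ⟨δ', rfl⟩ := mem_twistSet.mp hf'
  refine ⟨δ' * δ.symm, funext fun σ => ?_⟩
  change twist (δ' * δ.symm) (twist δ σ) = twist δ' σ
  rw [twist_mul, twist_symm_twist]

/-- `Ω_K` moves any embedding `x` onto every embedding (transitivity of `Aut_ℚ(ℚ̄)` on `Hom(K,
ℂ)`) -/
theorem image_eval_twistSet (x : K →+* ℂ) :
    (twistSet K).image (fun f => f x) = Finset.univ :=
  Finset.eq_univ_of_forall fun e => by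
    obtain ⟨γ, h⟩ := exists_twist_eq x e
    exact Finset.mem_image.mpr ⟨_, twist_mem_twistSet γ, h⟩

/-- **equidistribution of one slot**: summing `h (f x)` over `f ∈ Ω_K` gives `#Stab(x) · Σ_e h e` -/
theorem sum_twistSet_eval (x : K →+* ℂ) (h : (K →+* ℂ) → ℤ) :
    ∑ f ∈ twistSet K, h (f x) = (((twistSet K).filter fun f => f x = x).card : ℤ) * ∑ e, h e := by
  have key := sum_eq_card_fibre_mul_sum (comp_mem_twistSet (K := K)) comp_twist_injective
    twistSet_transitive (F := fun f => f x) (act := twist) (fun _ _ => rfl) h id_mem_twistSet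
  rw [image_eval_twistSet] at key
  exact key

/-- orbit–stabiliser for one slot: `#Ω_K = #Stab(x) · #Hom(K, ℂ)` -/
theorem card_twistSet_eq (x : K →+* ℂ) :
    (twistSet K).card = ((twistSet K).filter fun f => f x = x).card * Fintype.card (K →+* ℂ) := by
  have key := card_eq_card_fibre_mul (comp_mem_twistSet (K := K)) comp_twist_injective
    twistSet_transitive (F := fun f => f x) (act := twist) (fun _ _ => rfl) id_mem_twistSet
  rw [image_eval_twistSet, Finset.card_univ] at key
  exact key

/-- the pair orbit `O_{x,y} = {(γx, γy)} ⊆ Hom(K,ℂ)²` -/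
def pairSet (x y : K →+* ℂ) : Finset ((K →+* ℂ) × (K →+* ℂ)) :=
  (twistSet K).image fun f => (f x, f y)

/-- membership in the pair orbit: `q ∈ O_{x,y}` iff `q = (γx, γy)` for some `γ` -/
theorem mem_pairSet {x y : K →+* ℂ} {q : (K →+* ℂ) × (K →+* ℂ)} :
    q ∈ pairSet x y ↔ ∃ γ : Gam, (twist γ x, twist γ y) = q := by
  unfold pairSet
  rw [Finset.mem_image]
  constructor
  · rintro ⟨f, hf, rfl⟩
    obtain ⟨γ, rfl⟩ := mem_twistSet.mp hf
    exact ⟨γ, rfl⟩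
  · rintro ⟨γ, rfl⟩
    exact ⟨_, twist_mem_twistSet γ, rfl⟩

/-- `(γx, γy) ∈ O_{x,y}` -/
theorem twist_mem_pairSet {x y : K →+* ℂ} (γ : Gam) : (twist γ x, twist γ y) ∈ pairSet x y :=
  mem_pairSet.mpr ⟨γ, rfl⟩

/-- `(x, y) ∈ O_{x,y}` -/
theorem self_mem_pairSet (x y : K →+* ℂ) : (x, y) ∈ pairSet x y := by
  have h := twist_mem_pairSet (x := x) (y := y) 1
  rwa [twist_one, twist_one] at h

/-- **equidistribution of two slots**: summing `h (f x, f y)` over `f ∈ Ω_K` gives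
`#Stab(x,y) · Σ_{q ∈ O_{x,y}} h q` -/
theorem sum_twistSet_eval₂ (x y : K →+* ℂ) (h : (K →+* ℂ) × (K →+* ℂ) → ℤ) :
    ∑ f ∈ twistSet K, h (f x, f y)
      = (((twistSet K).filter fun f => (f x, f y) = (x, y)).card : ℤ) * ∑ q ∈ pairSet x y, h q := by
  have key := sum_eq_card_fibre_mul_sum (comp_mem_twistSet (K := K)) comp_twist_injective
    twistSet_transitive (F := fun f => (f x, f y)) (act := fun γ => Prod.map (twist γ) (twist γ))
    (fun _ _ => rfl) h id_mem_twistSet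
  exact key

/-- orbit–stabiliser for two slots: `#Ω_K = #Stab(x,y) · #O_{x,y}` -/
theorem card_twistSet_eq₂ (x y : K →+* ℂ) :
    (twistSet K).card = ((twistSet K).filter fun f => (f x, f y) = (x, y)).card * (pairSet x y).card := by
  have key := card_eq_card_fibre_mul (comp_mem_twistSet (K := K)) comp_twist_injective
    twistSet_transitive (F := fun f => (f x, f y)) (act := fun γ => Prod.map (twist γ) (twist γ))
    (fun _ _ => rfl) id_mem_twistSet
  exact key

/-- the pair orbit is stable under the diagonal twist by any `γ` -/
theorem pairSet_mapsTo {x y : K →+* ℂ} (γ : Gam) :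
    ∀ q ∈ pairSet x y, Prod.map (twist γ) (twist γ) q ∈ pairSet x y := fun q hq => by
  obtain ⟨δ, rfl⟩ := mem_pairSet.mp hq
  refine mem_pairSet.mpr ⟨γ * δ, ?_⟩
  rw [twist_mul, twist_mul]
  rfl

/-- the pair orbit is homogeneous under diagonal twists -/
theorem pairSet_transitive {x y : K →+* ℂ} :
    ∀ q ∈ pairSet x y, ∀ q' ∈ pairSet x y, ∃ γ : Gam, Prod.map (twist γ) (twist γ) q = q' := by
  intro q hq q' hq'
  obtain ⟨δ, rfl⟩ := mem_pairSet.mp hq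
  obtain ⟨δ', rfl⟩ := mem_pairSet.mp hq'
  refine ⟨δ' * δ.symm, ?_⟩
  change (twist (δ' * δ.symm) (twist δ x), twist (δ' * δ.symm) (twist δ y)) = _
  rw [twist_mul, twist_symm_twist, twist_mul, twist_symm_twist]

/-- the first projection of a pair orbit is all of `Hom(K, ℂ)` -/
theorem image_fst_pairSet (x y : K →+* ℂ) :
    (pairSet x y).image Prod.fst = Finset.univ :=
  Finset.eq_univ_of_forall fun e => by
    obtain ⟨γ, h⟩ := exists_twist_eq x e
    exact Finset.mem_image.mpr ⟨_, twist_mem_pairSet γ, h⟩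

/-- **the pair orbit is homogeneous over the first coordinate**: all fibres of `π₁ : O_{x,y} → Hom(K,ℂ)`
have the same size … -/
theorem card_fibre_pairSet {x y : K →+* ℂ} {q : (K →+* ℂ) × (K →+* ℂ)} (hq : q ∈ pairSet x y) :
    ((pairSet x y).filter fun u => u.1 = q.1).card = ((pairSet x y).filter fun u => u.1 = x).card := by
  have key := card_fibre_eq_of_homogeneous (pairSet_mapsTo (x := x) (y := y))
    (fun γ => (twist_injective γ).prodMap (twist_injective γ)) pairSet_transitive (F := Prod.fst)
    (act := twist) (fun _ _ => rfl) hq (self_mem_pairSet x y)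
  exact key

/-- … namely `#O_{x,y} / [K:ℚ]` -/
theorem card_pairSet_eq (x y : K →+* ℂ) :
    (pairSet x y).card = ((pairSet x y).filter fun u => u.1 = x).card * Fintype.card (K →+* ℂ) := by
  have key := card_eq_card_fibre_mul (pairSet_mapsTo (x := x) (y := y))
    (fun γ => (twist_injective γ).prodMap (twist_injective γ)) pairSet_transitive (F := Prod.fst)
    (act := twist) (fun _ _ => rfl) (self_mem_pairSet x y)
  rw [image_fst_pairSet, Finset.card_univ] at key
  exact key

end TwistSet

/-! ### 7. Inner products of slot sign vectors over `Ω_K` in CM degree `≤ 4`: `0` or `±#Ω_K` -/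

/-- `Trichot n v`: the trichotomy `v ∈ {0, n, -n}` -/
def Trichot (n : ℕ) (v : ℤ) : Prop := v = 0 ∨ v = n ∨ v = -(n : ℤ)

/-- a trichotomy scales up along a natural factor: `v ∈ {0, ±n} ⇒ c v ∈ {0, ±c n}` -/
theorem Trichot.mul {n : ℕ} {v : ℤ} (h : Trichot n v) (c : ℕ) : Trichot (c * n) (c * v) := by
  rcases h with rfl | rfl | rfl
  · exact Or.inl (mul_zero _)
  · exact Or.inr (Or.inl (by push_cast; ring))
  · exact Or.inr (Or.inr (by push_cast; ring))

/-- `TriInner K`: THE TRICHOTOMY — for all CM types `Ψ, Ψ'` and embeddings `x, y` of `K` the inner product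
over `Ω_K` of the slot sign vectors `f ↦ sgn_Ψ (f x)`, `f ↦ sgn_Ψ' (f y)` is `0` or `±#Ω_K`.  It holds in CM
degree `2` and `4` (`triInner_of_finrank_eq_two`, `triInner_of_finrank_eq_four`) and is all that §8 uses. -/
def TriInner (K : CMField) : Prop :=
  ∀ (Ψ Ψ' : CMType K) (x y : K →+* ℂ),
    Trichot (twistSet K).card (∑ f ∈ twistSet K, sgn Ψ (f x) * sgn Ψ' (f y))

section SamePlace

variable (K : CMField)

/-- **same place, any degree**: if even `±1`-valued functions of ONE slot have trichotomous sums over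
`Ω_K`, then so has the inner product of the sign vectors of two slots `x` and `y ∈ {x, x̄}`. -/
theorem tri_inner_of_same_place
    (heven : ∀ (h : (K →+* ℂ) → ℤ), (∀ e, h (conjugate e) = h e) → (∀ e, h e = 1 ∨ h e = -1) →
      ∀ x, Trichot (twistSet K).card (∑ f ∈ twistSet K, h (f x)))
    (Ψ Ψ' : CMType K) (x y : K →+* ℂ) (hy : y = x ∨ y = conjugate x) :
    Trichot (twistSet K).card (∑ f ∈ twistSet K, sgn Ψ (f x) * sgn Ψ' (f y)) := by
  have hpm : ∀ (Ψ₁ Ψ₂ : CMType K) (e e' : K →+* ℂ),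
      sgn Ψ₁ e * sgn Ψ₂ e' = 1 ∨ sgn Ψ₁ e * sgn Ψ₂ e' = -1 := by
    intro Ψ₁ Ψ₂ e e'
    rcases sgn_eq_or Ψ₁ e with h | h <;> rcases sgn_eq_or Ψ₂ e' with h' | h' <;> rw [h, h'] <;> norm_num
  rcases hy with rfl | rfl
  · exact heven (fun e => sgn Ψ e * sgn Ψ' e)
      (fun e => by rw [sgn_conjugate, sgn_conjugate]; ring) (fun e => hpm Ψ Ψ' e e) _
  · have heq : ∑ f ∈ twistSet K, sgn Ψ (f x) * sgn Ψ' (f (conjugate x))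
        = ∑ f ∈ twistSet K, (fun e => sgn Ψ e * sgn Ψ' (conjugate e)) (f x) := by
      refine Finset.sum_congr rfl fun f hf => ?_
      obtain ⟨γ, rfl⟩ := mem_twistSet.mp hf
      change sgn Ψ (twist γ x) * sgn Ψ' (twist γ (conjugate x))
        = sgn Ψ (twist γ x) * sgn Ψ' (conjugate (twist γ x))
      rw [twist_conjugate]
    rw [heq]
    exact heven (fun e => sgn Ψ e * sgn Ψ' (conjugate e))
      (fun e => by rw [conjugate_conjugate, sgn_conjugate, sgn_conjugate]; ring)
      (fun e => hpm Ψ Ψ' e (conjugate e)) x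

end SamePlace

section Inner₂

open scoped Classical

variable (K : CMField) (h2 : Module.finrank ℚ K = 2)
include h2

/-- **one place, degree two**: for an even `±1`-valued `h`, `Σ_{f ∈ Ω} h (f x) = ±#Ω` (the slot `f x` is
equidistributed over `x, x̄` and `h x = h x̄`) -/
theorem tri_sum_twistSet_even₂ (Ψ₀ : CMType K) (h : (K →+* ℂ) → ℤ) (heven : ∀ e, h (conjugate e) = h e)
    (hval : ∀ e, h e = 1 ∨ h e = -1) (x : K →+* ℂ) :
    Trichot (twistSet K).card (∑ f ∈ twistSet K, h (f x)) := by
  unfold Trichot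
  rw [sum_twistSet_eval x h, card_twistSet_eq x, NumberField.Embeddings.card K ℂ, h2,
    sum_univ_of_finrank_eq_two Ψ₀ h2 x h, heven]
  rcases hval x with hx | hx <;> rw [hx]
  · exact Or.inr (Or.inl (by push_cast; ring))
  · exact Or.inr (Or.inr (by push_cast; ring))

/-- **the trichotomy in CM degree two** (every pair of slots lies over the one place) -/
theorem triInner_of_finrank_eq_two : TriInner K := fun Ψ Ψ' x y =>
  tri_inner_of_same_place K (fun h he hv => tri_sum_twistSet_even₂ K h2 Ψ h he hv) Ψ Ψ' x y
    (eq_or_of_finrank_eq_two Ψ h2 x y)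

end Inner₂

end HodgeCM.Toy

end
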